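import Literature.Analysis.FluidPDE.OseenTensorKernel
import Literature.Analysis.FluidPDE.OseenKernelSectorBounds
import HarnessLib

/-!
# The complexified Oseen tensor and its sector bounds

Analysis/FluidPDE definitions-layer file for the proof of the named fact
`Literature.Analysis.FluidPDE.bradshawGrujicKukavica2015_local_analyticity_radius`
(Bradshaw–Grujić–Kukavica 2015, Thm. 2.3, §4: the projected forcing of the localised equation,
continued in the space variable). The Oseen tensor `𝒪_τ(z)a = (G_τ(z) - A₁(τ,z))a + A(τ,z)⟪z,a⟫z`
(`OseenTensorKernel.lean`) is continued exactly as the Oseen–Koch–Tataru kernel in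
`OseenKernelComplex.lean` (root time `m`, bilinear square `ζ·ζ`, the weights through the entire
functions `Ψ_q`):

* `oseenWeightA1C m ζ = (4π)^{-d/2} m^{-d} 2⁻¹ Ψ_{d/2+1}(ζ·ζ/4m²)` — the continuation of `A₁`
  (`oseenWeightA1C_sqrt_complexify`), holomorphic on `m ≠ 0`, with the **sector bound**
  `‖oseenWeightA1C ρ (cx z - iη)‖ ≤ e² (25/6)^{d/2} A₁((25/6)ρ², z)` for admissible shifts
  `‖η‖ ≤ ‖z‖/2 + ρ` (`norm_oseenWeightA1C_imShift_le`);
* `oseenTensorC m ζ a = (heatKernelC m ζ - oseenWeightA1C m ζ) a + oseenWeightAC m ζ (ζ·a) ζ` —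
  the continuation of `𝒪` (`oseenTensorC_sqrt_complexify`), holomorphic, linear in `a`, with the
  sector bound `norm_oseenTensorC_imShift_le` in terms of the real Gaussian and weights at the
  dilated time `(25/6)ρ²`.

## References

* P. G. Lemarié-Rieusset, *The Navier–Stokes Problem in the 21st Century* (2016), §6.2 and
  Thm. 9.12 (proof, pp. 261–262). [LemarieRieusset2016]
* H. Koch, D. Tataru, Adv. Math. 157 (2001), §2 (6)–(8). [KochTataruAdvMath2001]
-/

noncomputable section

open MeasureTheory Set Filter Metric Real
open _root_.Topology
open scoped BigOperators InnerProductSpace RealInnerProductSpace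

namespace Literature.Analysis.FluidPDE

open Literature.Analysis.FunctionSpaces.EuclideanSpace (complexify complexify_apply norm_complexify)
open UnboundedOperators (heatKernel)

variable {ι : Type*} [Fintype ι]

/-! ### The complexified weight `A₁` -/

/-- **The complexified weight `A₁`**:
`oseenWeightA1C m ζ = (4π)^{-d/2} m^{-d} 2⁻¹ Ψ_{d/2+1}(ζ·ζ/4m²)`, the continuation of
`A₁(t, z) = ∫_t^∞ G_s(z)/(2s) ds` (`oseenWeightA1`; equality at `m = √t`, `ζ = cx z`:
`oseenWeightA1C_sqrt_complexify`). [cite: LemarieRieusset2016, §6.2] -/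
def oseenWeightA1C (m : ℂ) (ζ : EuclideanSpace ℂ ι) : ℂ :=
  (heatConst ι : ℂ) * (m ^ Fintype.card ι)⁻¹ * (2 : ℂ)⁻¹ *
    psiWeight (Fintype.card ι / 2 + 1) (cdot ζ ζ * (4 * m ^ 2)⁻¹)

/-- **Real restriction of the weight `A₁`**: `oseenWeightA1C √t (cx z) = A₁(t, z)` for `t > 0`.
[folklore] -/
theorem oseenWeightA1C_sqrt_complexify {t : ℝ} (ht : 0 < t) (z : EuclideanSpace ℝ ι) :
    oseenWeightA1C (Real.sqrt t : ℂ) (complexify z) = ((oseenWeightA1 t z : ℝ) : ℂ) := by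
  unfold oseenWeightA1C oseenWeightA1
  rw [heatConst_mul_inv_sqrt_pow ht, cdot_complexify_div_sqrt ht z, psiWeight_ofReal,
    integral_Ioi_heatKernel_div_pow ht z (by norm_num : (2 : ℝ) ≠ 0) 1]
  have htne : (t : ℂ) ≠ 0 := Complex.ofReal_ne_zero.2 ht.ne'
  push_cast
  field_simp

/-- **Holomorphy of the complexified weight `A₁`** (with `Ψ_{d/2+1}` entire; `1 ≤ d`). [folklore] -/
theorem _root_.DifferentiableAt.oseenWeightA1C [Nonempty ι] {P : Type*} [NormedAddCommGroup P]
    [NormedSpace ℂ P] {fm : P → ℂ} {fζ : P → EuclideanSpace ℂ ι} {p : P}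
    (hm : DifferentiableAt ℂ fm p) (hζ : DifferentiableAt ℂ fζ p) (h0 : fm p ≠ 0) :
    DifferentiableAt ℂ (fun r => oseenWeightA1C (fm r) (fζ r)) p := by
  unfold Literature.Analysis.FluidPDE.oseenWeightA1C
  have hq : (1 : ℝ) < Fintype.card ι / 2 + 1 := by
    have : (1 : ℝ) ≤ Fintype.card ι := by exact_mod_cast Fintype.card_pos
    linarith
  refine ((((differentiableAt_const _).mul ((hm.pow _).inv (pow_ne_zero _ h0))).mul
    (differentiableAt_const _))).mul ?_
  exact (differentiableAt_cdot_div hm hζ h0).psiWeight hq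

/-- `Ψ_{d/2+1}` at the real Gaussian argument is the weight `A₁`:
`∫_{σ>1} σ^{-(d/2+1)} e^{-(|z|²/4τ)/σ} dσ = (4πτ)^{d/2} · 2 · A₁(τ, z)`. [folklore] -/
theorem psi_real_eq_oseenWeightA1 {τ : ℝ} (hτ : 0 < τ) (z : EuclideanSpace ℝ ι) :
    ∫ σ in Ioi (1 : ℝ), σ ^ (-((Fintype.card ι : ℝ) / 2 + 1)) * Real.exp (-(‖z‖ ^ 2 / (4 * τ) / σ)) =
      (4 * π * τ) ^ ((Module.finrank ℝ (EuclideanSpace ℝ ι) : ℝ) / 2) * 2 * oseenWeightA1 τ z := by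
  have h := integral_Ioi_heatKernel_div_pow hτ z (by norm_num : (2 : ℝ) ≠ 0) 1
  unfold oseenWeightA1
  rw [h]
  have hpos : 0 < 4 * π * τ := by positivity
  have e : (4 * π * τ) ^ ((Module.finrank ℝ (EuclideanSpace ℝ ι) : ℝ) / 2) *
      (4 * π * τ) ^ (-(Module.finrank ℝ (EuclideanSpace ℝ ι) : ℝ) / 2) = 1 := by
    rw [← Real.rpow_add hpos]; ring_nf; exact Real.rpow_zero _
  have e1 : ((1 : ℕ) : ℝ) = 1 := by norm_num
  simp only [Nat.cast_one, pow_one]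
  calc _ = ((4 * π * τ) ^ ((Module.finrank ℝ (EuclideanSpace ℝ ι) : ℝ) / 2) *
        (4 * π * τ) ^ (-(Module.finrank ℝ (EuclideanSpace ℝ ι) : ℝ) / 2)) *
        ∫ σ in Ioi (1 : ℝ), σ ^ (-((Fintype.card ι : ℝ) / 2 + 1)) * Real.exp (-(‖z‖ ^ 2 / (4 * τ) / σ)) := by
          rw [e, one_mul]
    _ = _ := by field_simp

/-- **The complexified weight `A₁` against the real one** at real root time and admissible
imaginary shifts: `‖oseenWeightA1C ρ (cx z - iη)‖ ≤ e² (25/6)^{d/2} A₁((25/6)ρ², z)`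
(positive dimension). [folklore] -/
theorem norm_oseenWeightA1C_imShift_le [Nonempty ι] {ρ : ℝ} (hρ : 0 < ρ) {z η : EuclideanSpace ℝ ι}
    (hη : ‖η‖ ≤ ‖z‖ / 2 + ρ) :
    ‖oseenWeightA1C (ρ : ℂ) (complexify z - Complex.I • complexify η)‖ ≤
      Real.exp 2 * (25 / 6 : ℝ) ^ ((Fintype.card ι : ℝ) / 2) * oseenWeightA1 (25 / 6 * ρ ^ 2) z := by
  have hm : 0 < ((ρ : ℂ)).re := ofReal_re_pos hρ
  set τ' : ℝ := 25 / 6 * ρ ^ 2 with hτ'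
  have hlam : (0 : ℝ) < 25 / 6 := by norm_num
  have hτ'0 : 0 < τ' := by positivity
  have hE : 0 < Module.finrank ℝ (EuclideanSpace ℝ ι) := by
    rw [finrank_euclideanSpace]; exact Fintype.card_pos
  have hq : (1 : ℝ) < Fintype.card ι / 2 + 1 := by
    have : (1 : ℝ) ≤ Fintype.card ι := by exact_mod_cast Fintype.card_pos
    linarith
  unfold oseenWeightA1C
  rw [norm_mul, norm_mul, norm_mul, Complex.norm_real, Real.norm_of_nonneg heatConst_pos.le]
  have h1 : ‖(((ρ : ℂ)) ^ Fintype.card ι)⁻¹‖ ≤ (ρ ^ Fintype.card ι)⁻¹ := by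
    have := norm_inv_pow_le hm (Fintype.card ι); rwa [Complex.ofReal_re] at this
  have h2 : ‖((2 : ℂ))⁻¹‖ = (2 : ℝ)⁻¹ := by simp
  have h3 := norm_psiWeight_quadForm_le_of_imShift hρ hη hq
  rw [psi_real_eq_oseenWeightA1 hτ'0 z] at h3
  obtain ⟨-, hA0, -⟩ := (exists_oseenWeightA1_le (E := (EuclideanSpace ℝ ι)) hE).choose_spec.2 hτ'0 z
  have hkey := heatConst_mul_inv_pow_eq (ι := ι) hρ hlam
  set d : ℝ := (Fintype.card ι : ℝ) with hd
  have hfin : (Module.finrank ℝ (EuclideanSpace ℝ ι) : ℝ) = d := by rw [finrank_euclideanSpace]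
  rw [hfin] at hkey h3
  have hpos : 0 < 4 * π * τ' := by positivity
  have e : (4 * π * τ') ^ (-d / 2) * (4 * π * τ') ^ (d / 2) = 1 := by
    rw [← Real.rpow_add hpos]; ring_nf; exact Real.rpow_zero _
  rw [h2]
  calc _ ≤ heatConst ι * (ρ ^ Fintype.card ι)⁻¹ * (2 : ℝ)⁻¹ *
          (Real.exp 2 * ((4 * π * τ') ^ (d / 2) * 2 * oseenWeightA1 τ' z)) := by
        have hψ0 : 0 ≤ Real.exp 2 * ((4 * π * τ') ^ (d / 2) * 2 * oseenWeightA1 τ' z) := by positivity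
        exact mul_le_mul (mul_le_mul_of_nonneg_right (mul_le_mul_of_nonneg_left h1 heatConst_pos.le)
          (by norm_num)) h3 (norm_nonneg _) (mul_nonneg (mul_nonneg heatConst_pos.le (by positivity)) (by norm_num))
    _ = Real.exp 2 * (25 / 6 : ℝ) ^ (d / 2) *
          ((4 * π * τ') ^ (-d / 2) * (4 * π * τ') ^ (d / 2)) * oseenWeightA1 τ' z := by
        rw [hkey, hτ']; field_simp
    _ = Real.exp 2 * (25 / 6 : ℝ) ^ (d / 2) * oseenWeightA1 τ' z := by rw [e, mul_one]

/-! ### The complexified Oseen tensor -/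

/-- **The complexified Oseen tensor**:
`oseenTensorC m ζ a = (heatKernelC m ζ - oseenWeightA1C m ζ) a + oseenWeightAC m ζ (ζ·a) ζ`, the
continuation of `𝒪_t(z)a` (`oseenTensorC_sqrt_complexify`). [cite: LemarieRieusset2016, §6.2] -/
def oseenTensorC (m : ℂ) (ζ a : EuclideanSpace ℂ ι) : EuclideanSpace ℂ ι :=
  (heatKernelC m ζ - oseenWeightA1C m ζ) • a + (oseenWeightAC m ζ * cdot ζ a) • ζ

/-- Unfolding lemma. [folklore] -/
theorem oseenTensorC_apply (m : ℂ) (ζ a : EuclideanSpace ℂ ι) :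
    oseenTensorC m ζ a = (heatKernelC m ζ - oseenWeightA1C m ζ) • a + (oseenWeightAC m ζ * cdot ζ a) • ζ := rfl

/-- **Real restriction of the complexified Oseen tensor**:
`oseenTensorC √t (cx z) (cx a) = cx (𝒪_t(z) a)` for `t > 0`. [folklore] -/
theorem oseenTensorC_sqrt_complexify {t : ℝ} (ht : 0 < t) (z a : EuclideanSpace ℝ ι) :
    oseenTensorC (Real.sqrt t : ℂ) (complexify z) (complexify a) = complexify (oseenTensor t z a) := by
  rw [oseenTensorC_apply, oseenTensor_apply, heatKernelC_sqrt_complexify ht, oseenWeightA1C_sqrt_complexify ht,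
    oseenWeightAC_sqrt_complexify ht, cdot_complexify, map_add, complexify_smul, complexify_smul]
  push_cast
  rfl

/-- `oseenTensorC` vanishes on the zero tensor slot. [folklore] -/
@[simp] theorem oseenTensorC_zero (m : ℂ) (ζ : EuclideanSpace ℂ ι) : oseenTensorC m ζ 0 = 0 := by
  simp [oseenTensorC_apply]

/-- `oseenTensorC` is additive in the tensor slot. [folklore] -/
theorem oseenTensorC_add (m : ℂ) (ζ a a' : EuclideanSpace ℂ ι) :
    oseenTensorC m ζ (a + a') = oseenTensorC m ζ a + oseenTensorC m ζ a' := by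
  simp only [oseenTensorC_apply, cdot_add_right, smul_add, mul_add, add_smul]
  abel

/-- `oseenTensorC` respects subtraction in the tensor slot. [folklore] -/
theorem oseenTensorC_sub (m : ℂ) (ζ a a' : EuclideanSpace ℂ ι) :
    oseenTensorC m ζ (a - a') = oseenTensorC m ζ a - oseenTensorC m ζ a' := by
  rw [eq_sub_iff_add_eq, ← oseenTensorC_add, sub_add_cancel]

/-- **Holomorphy of the complexified Oseen tensor in all its arguments** (`fm p ≠ 0`). [folklore] -/
theorem _root_.DifferentiableAt.oseenTensorC [Nonempty ι] {P : Type*} [NormedAddCommGroup P]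
    [NormedSpace ℂ P] {fm : P → ℂ} {fζ fa : P → EuclideanSpace ℂ ι} {p : P}
    (hm : DifferentiableAt ℂ fm p) (hζ : DifferentiableAt ℂ fζ p) (ha : DifferentiableAt ℂ fa p)
    (h0 : fm p ≠ 0) :
    DifferentiableAt ℂ (fun r => oseenTensorC (fm r) (fζ r) (fa r)) p := by
  unfold Literature.Analysis.FluidPDE.oseenTensorC
  exact (((hm.heatKernelC hζ h0).sub (hm.oseenWeightA1C hζ h0)).smul ha).add
    (((hm.oseenWeightAC hζ h0).mul (hζ.cdot ha)).smul hζ)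

/-- **The sector bound for the complexified Oseen tensor**: at real root time `ρ > 0` and an
admissible imaginary shift `‖η‖ ≤ ‖z‖/2 + ρ`, with `τ' = (25/6)ρ²`,
`‖oseenTensorC ρ (cx z - iη) a‖ ≤ e²(25/6)^{d/2} (G_{τ'}(z) + A₁(τ',z) + (25/6)(3‖z‖/2+ρ)² A(τ',z)) ‖a‖`.
[folklore] -/
theorem norm_oseenTensorC_imShift_le [Nonempty ι] {ρ : ℝ} (hρ : 0 < ρ) {z η : EuclideanSpace ℝ ι}
    (hη : ‖η‖ ≤ ‖z‖ / 2 + ρ) (a : EuclideanSpace ℂ ι) :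
    ‖oseenTensorC (ρ : ℂ) (complexify z - Complex.I • complexify η) a‖ ≤
      Real.exp 2 * (25 / 6 : ℝ) ^ ((Fintype.card ι : ℝ) / 2) *
        (heatKernel (25 / 6 * ρ ^ 2) z + oseenWeightA1 (25 / 6 * ρ ^ 2) z +
          (25 / 6) * (3 * ‖z‖ / 2 + ρ) ^ 2 * oseenWeightA (25 / 6 * ρ ^ 2) z) * ‖a‖ := by
  set ζ : EuclideanSpace ℂ ι := complexify z - Complex.I • complexify η with hζ
  set K₀ : ℝ := Real.exp 2 * (25 / 6 : ℝ) ^ ((Fintype.card ι : ℝ) / 2) with hK₀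
  set τ' : ℝ := 25 / 6 * ρ ^ 2 with hτ'
  have hτ'0 : 0 < τ' := by positivity
  have hE : 0 < Module.finrank ℝ (EuclideanSpace ℝ ι) := by
    rw [finrank_euclideanSpace]; exact Fintype.card_pos
  have hζn : ‖ζ‖ ≤ 3 * ‖z‖ / 2 + ρ := by
    calc ‖ζ‖ ≤ ‖complexify z‖ + ‖Complex.I • complexify η‖ := norm_sub_le _ _
      _ = ‖z‖ + ‖η‖ := by rw [norm_smul, Complex.norm_I, one_mul, norm_complexify, norm_complexify]
      _ ≤ 3 * ‖z‖ / 2 + ρ := by linarith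
  have hG := norm_heatKernelC_imShift_le hρ hη
  have hA1 := norm_oseenWeightA1C_imShift_le hρ hη
  have hA := norm_oseenWeightAC_imShift_le hρ hη
  obtain ⟨-, hA0, -⟩ := (exists_oseenWeightA_le (E := (EuclideanSpace ℝ ι))).choose_spec.2 hτ'0 z
  have hApow : Real.exp 2 * (25 / 6 : ℝ) ^ ((Fintype.card ι : ℝ) / 2 + 1) = K₀ * (25 / 6) := by
    rw [hK₀, Real.rpow_add (by norm_num : (0 : ℝ) < 25 / 6), Real.rpow_one]; ring
  rw [hApow] at hA
  rw [oseenTensorC_apply]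
  calc ‖(heatKernelC (ρ : ℂ) ζ - oseenWeightA1C (ρ : ℂ) ζ) • a + (oseenWeightAC (ρ : ℂ) ζ * cdot ζ a) • ζ‖
      ≤ ‖(heatKernelC (ρ : ℂ) ζ - oseenWeightA1C (ρ : ℂ) ζ) • a‖ + ‖(oseenWeightAC (ρ : ℂ) ζ * cdot ζ a) • ζ‖ :=
        norm_add_le _ _
    _ ≤ (K₀ * heatKernel τ' z + K₀ * oseenWeightA1 τ' z) * ‖a‖ +
          (K₀ * (25 / 6) * oseenWeightA τ' z) * ((3 * ‖z‖ / 2 + ρ) * ‖a‖) * (3 * ‖z‖ / 2 + ρ) := by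
        rw [norm_smul, norm_smul, norm_mul]
        have hc : ‖cdot ζ a‖ ≤ (3 * ‖z‖ / 2 + ρ) * ‖a‖ :=
          (norm_cdot_le _ _).trans (mul_le_mul_of_nonneg_right hζn (norm_nonneg _))
        have hcoef : ‖heatKernelC (ρ : ℂ) ζ - oseenWeightA1C (ρ : ℂ) ζ‖ ≤
            K₀ * heatKernel τ' z + K₀ * oseenWeightA1 τ' z := (norm_sub_le _ _).trans (add_le_add hG hA1)
        have hAn : 0 ≤ K₀ * (25 / 6) * oseenWeightA τ' z := mul_nonneg (by positivity) hA0
        refine add_le_add (mul_le_mul_of_nonneg_right hcoef (norm_nonneg _)) ?_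
        exact mul_le_mul (mul_le_mul hA hc (norm_nonneg _) hAn) hζn (norm_nonneg _)
          (mul_nonneg hAn (by positivity))
    _ = K₀ * (heatKernel τ' z + oseenWeightA1 τ' z + (25 / 6) * (3 * ‖z‖ / 2 + ρ) ^ 2 * oseenWeightA τ' z) * ‖a‖ := by
        ring

end Literature.Analysis.FluidPDE
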